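import Literature.Geometry.Riemannian.UniformTimeTaylorBounds
import Literature.Geometry.Lorentzian.CoordCurvature
import HarnessLib

/-!
# Space derivatives of a smooth family and their commutation with the time derivative

A calculus brick (K3b of the notes) of the proof of the named fact
`Literature.Geometry.Riemannian.BarHanke2023_thm27_umbilicNormalForm` (Bär–Hanke, *Boundary
conditions for scalar curvature*, §3, Thm. 27). For a family `F : V → ℝ → W` with
`Φ(y, s) = F y s` of class `C^∞` on `U × ℝ` (`U` open), the `y`-derivatives of the slices
`F(·, s)` are the restrictions `DΦ(y,s) ∘ ι`, `ι(u) = (u, 0)`, of the total derivative — again a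
`C^∞` family (`contDiffOn_familyFDeriv`, `fderiv_slice_eq_familyFDeriv`) — and **the time
derivative commutes with the space derivative**:
`D_y (∂_s F)(y, s) = ∂_s (D_y F)(y, s)` (`fderiv_deriv_eq_deriv_familyFDeriv`, by the symmetry
of `D²Φ`, `ContDiffAt.isSymmSndFDerivAt`). Iterating once (`fderiv_fderiv_deriv_eq`), the first
two `y`-derivatives of the initial velocity `Ḟ(·, 0)` of the slice family are time derivatives at
`s = 0` of the smooth families `D_yF`, `D²_yF`, to which the uniform Taylor bounds of
`UniformTimeTaylorBounds.lean` apply. This is the bookkeeping behind "`g_t − g₀ − tġ₀ = O(t²)` in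
`C²`" in the proofs of Bär–Hanke's Props. 23 and 26 ((18)–(21)).

Everything is proved; no definitions, no named facts (D-0026).

## References

* C. Bär, B. Hanke, *Boundary conditions for scalar curvature*, arXiv:2012.09127, §3, proofs of
  Props. 23 and 26. [BarHanke2023]
* H. Cartan, *Calcul différentiel* (1967), Ch. I, §5 (symmetry of the second derivative).
  [folklore]
-/

noncomputable section

set_option maxSynthPendingDepth 3

open Set Filter Function Metric
open scoped Topology ContDiff

namespace Literature.Geometry.Riemannian

open Literature.Geometry.Lorentzian Literature.Geometry.Lorentzian.MetricCoord

variable {V : Type*} [NormedAddCommGroup V] [NormedSpace ℝ V]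
  {W : Type*} [NormedAddCommGroup W] [NormedSpace ℝ W]
  {F : V → ℝ → W} {U : Set V}

/-- **The space derivative of a slice is the restriction of the total derivative**:
`D(F(·,s))(y) = DΦ(y,s) ∘ ι` for `y ∈ U`. [folklore] -/
theorem hasFDerivAt_slice (hU : IsOpen U)
    (hF : ContDiffOn ℝ ∞ (fun q : V × ℝ ↦ F q.1 q.2) (U ×ˢ univ)) {y : V} (hy : y ∈ U) (s : ℝ) :
    HasFDerivAt (fun y ↦ F y s)
      ((fderiv ℝ (fun q : V × ℝ ↦ F q.1 q.2) (y, s)).comp (ContinuousLinearMap.inl ℝ V ℝ)) y := by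
  have hq : ((y, s) : V × ℝ) ∈ U ×ˢ (univ : Set ℝ) := ⟨hy, mem_univ _⟩
  have hd : HasFDerivAt (fun q : V × ℝ ↦ F q.1 q.2)
      (fderiv ℝ (fun q : V × ℝ ↦ F q.1 q.2) (y, s)) (y, s) :=
    ((hF.differentiableOn (by simp)).differentiableAt
      ((hU.prod isOpen_univ).mem_nhds hq)).hasFDerivAt
  exact hd.comp y (hasFDerivAt_prodMk_left (𝕜 := ℝ) y s)

/-- `fderiv` form of `hasFDerivAt_slice`. [folklore] -/
theorem fderiv_slice_eq_familyFDeriv (hU : IsOpen U)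
    (hF : ContDiffOn ℝ ∞ (fun q : V × ℝ ↦ F q.1 q.2) (U ×ˢ univ)) {y : V} (hy : y ∈ U) (s : ℝ) :
    fderiv ℝ (fun y ↦ F y s) y =
      (fderiv ℝ (fun q : V × ℝ ↦ F q.1 q.2) (y, s)).comp (ContinuousLinearMap.inl ℝ V ℝ) :=
  (hasFDerivAt_slice hU hF hy s).fderiv

/-- **The space-derivative family is again a smooth family**: `(y, s) ↦ DΦ(y,s) ∘ ι` is `C^∞` on
`U × ℝ`. [folklore] -/
theorem contDiffOn_familyFDeriv (hU : IsOpen U)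
    (hF : ContDiffOn ℝ ∞ (fun q : V × ℝ ↦ F q.1 q.2) (U ×ˢ univ)) :
    ContDiffOn ℝ ∞ (fun q : V × ℝ ↦ (fun (y : V) (s : ℝ) ↦
        (fderiv ℝ (fun q : V × ℝ ↦ F q.1 q.2) (y, s)).comp (ContinuousLinearMap.inl ℝ V ℝ))
        q.1 q.2) (U ×ˢ univ) := by
  have h1 : ContDiffOn ℝ ∞ (fderiv ℝ (fun q : V × ℝ ↦ F q.1 q.2)) (U ×ˢ univ) :=
    hF.fderiv_of_isOpen (m := ∞) (hU.prod isOpen_univ) le_rfl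
  exact ((ContinuousLinearMap.precomp W (ContinuousLinearMap.inl ℝ V ℝ)).contDiff.comp_contDiffOn
    h1).congr fun q _ ↦ rfl

/-- **Time and space derivatives commute**: for `y ∈ U`,
`D_y (∂_s F)(y, s) = ∂_s (DΦ(y,·) ∘ ι)(s)` (symmetry of `D²Φ(y,s)`).
[cite: BarHanke2023, §3, proof of Prop. 26] -/
theorem fderiv_deriv_eq_deriv_familyFDeriv (hU : IsOpen U)
    (hF : ContDiffOn ℝ ∞ (fun q : V × ℝ ↦ F q.1 q.2) (U ×ˢ univ)) {y : V} (hy : y ∈ U) (s : ℝ) :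
    fderiv ℝ (fun y ↦ deriv (F y) s) y =
      deriv (fun σ ↦ (fderiv ℝ (fun q : V × ℝ ↦ F q.1 q.2) (y, σ)).comp
        (ContinuousLinearMap.inl ℝ V ℝ)) s := by
  set Φ : V × ℝ → W := fun q ↦ F q.1 q.2 with hΦ
  have hUo : IsOpen (U ×ˢ (univ : Set ℝ)) := hU.prod isOpen_univ
  have hq : ((y, s) : V × ℝ) ∈ U ×ˢ (univ : Set ℝ) := ⟨hy, mem_univ _⟩
  -- `D²Φ(y,s)` exists and is symmetric
  have hΦ₁ : ContDiffOn ℝ ∞ (fderiv ℝ Φ) (U ×ˢ univ) := hF.fderiv_of_isOpen (m := ∞) hUo le_rfl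
  have hdd : HasFDerivAt (fderiv ℝ Φ) (fderiv ℝ (fderiv ℝ Φ) (y, s)) (y, s) :=
    ((hΦ₁.differentiableOn (by simp)).differentiableAt (hUo.mem_nhds hq)).hasFDerivAt
  have hsymm : IsSymmSndFDerivAt ℝ Φ (y, s) :=
    (hF.contDiffAt (hUo.mem_nhds hq)).isSymmSndFDerivAt two_le_infty
  -- left-hand side: `y' ↦ ∂_s F y' s = DΦ(y', s)(0,1)` near `y`
  have hev : (fun y' ↦ deriv (F y') s) =ᶠ[𝓝 y] fun y' ↦ fderiv ℝ Φ (y', s) ((0 : V), (1 : ℝ)) := by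
    filter_upwards [hU.mem_nhds hy] with y' hy'
    exact (hasDerivAt_family_of_contDiffOn hU hF hy' s).deriv
  have hL : HasFDerivAt (fun y' ↦ fderiv ℝ Φ (y', s) ((0 : V), (1 : ℝ)))
      (((fderiv ℝ (fderiv ℝ Φ) (y, s)).comp (ContinuousLinearMap.inl ℝ V ℝ)).flip
        ((0 : V), (1 : ℝ))) y :=
    hasFDerivAt_clm_apply_const (hdd.comp y (hasFDerivAt_prodMk_left (𝕜 := ℝ) y s)) _
  rw [hev.fderiv_eq, hL.fderiv]
  -- right-hand side: the time derivative of `σ ↦ DΦ(y,σ) ∘ ι`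
  have hR0 : HasDerivAt (fun σ ↦ fderiv ℝ Φ (y, σ))
      (fderiv ℝ (fderiv ℝ Φ) (y, s) ((0 : V), (1 : ℝ))) s :=
    hdd.comp_hasDerivAt s ((hasDerivAt_const s y).prodMk (hasDerivAt_id s))
  set L : (V × ℝ →L[ℝ] W) →L[ℝ] V →L[ℝ] W :=
    ContinuousLinearMap.precomp W (ContinuousLinearMap.inl ℝ V ℝ) with hL'
  have hR := L.hasFDerivAt.comp_hasDerivAt s hR0
  have hfun : (fun σ ↦ (fderiv ℝ Φ (y, σ)).comp (ContinuousLinearMap.inl ℝ V ℝ)) =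
      ⇑L ∘ fun σ ↦ fderiv ℝ Φ (y, σ) := rfl
  rw [hfun, hR.deriv]
  ext u
  simp only [hL', ContinuousLinearMap.precomp_apply, ContinuousLinearMap.flip_apply,
    ContinuousLinearMap.coe_comp, Function.comp_apply, ContinuousLinearMap.inl_apply]
  exact hsymm _ _

/-- **Second space derivative of the initial velocity**: `D²_y (∂_s F)(·, s)(y)` is the time
derivative at `s` of the second space-derivative family, i.e. of
`σ ↦ D_y(DΦ(·,σ) ∘ ι)(y)`; stated with the first space-derivative family `F₁` and its own
space-derivative family (apply `fderiv_deriv_eq_deriv_familyFDeriv` twice). [folklore] -/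
theorem fderiv_fderiv_deriv_eq (hU : IsOpen U)
    (hF : ContDiffOn ℝ ∞ (fun q : V × ℝ ↦ F q.1 q.2) (U ×ˢ univ)) {y : V} (hy : y ∈ U) (s : ℝ) :
    fderiv ℝ (fderiv ℝ (fun y ↦ deriv (F y) s)) y =
      deriv (fun σ ↦ (fderiv ℝ (fun q : V × ℝ ↦
        (fun (y : V) (s : ℝ) ↦ (fderiv ℝ (fun q : V × ℝ ↦ F q.1 q.2) (y, s)).comp
          (ContinuousLinearMap.inl ℝ V ℝ)) q.1 q.2) (y, σ)).comp
        (ContinuousLinearMap.inl ℝ V ℝ)) s := by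
  -- the first space-derivative family `F₁`
  set F₁ : V → ℝ → V →L[ℝ] W := fun y s ↦
    (fderiv ℝ (fun q : V × ℝ ↦ F q.1 q.2) (y, s)).comp (ContinuousLinearMap.inl ℝ V ℝ) with hF₁
  have hF₁s : ContDiffOn ℝ ∞ (fun q : V × ℝ ↦ F₁ q.1 q.2) (U ×ˢ univ) :=
    contDiffOn_familyFDeriv hU hF
  -- `D_y(∂_s F) = ∂_s F₁` on the open set `U`, hence their space derivatives agree at `y`
  have hev : (fun y' ↦ fderiv ℝ (fun y ↦ deriv (F y) s) y') =ᶠ[𝓝 y]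
      fun y' ↦ deriv (F₁ y') s := by
    filter_upwards [hU.mem_nhds hy] with y' hy'
    exact fderiv_deriv_eq_deriv_familyFDeriv hU hF hy' s
  rw [hev.fderiv_eq]
  exact fderiv_deriv_eq_deriv_familyFDeriv (F := F₁) hU hF₁s hy s

end Literature.Geometry.Riemannian

end
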